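import Summits.Langlands.Langlands.Theses.OrdinaryPrimeTransport
import Summits.Langlands.Langlands.Theorems.IrreducibilityBySelfDualityReciprocityUpToIrreducibilityDeRhamBlocks
import Summits.Langlands.Langlands.Theorems.IrreducibilityBySelfDualityReciprocityUpToIrreducibilityGeometricConstituents
import Summits.Langlands.Langlands.Theorems.IrreducibilityBySelfDualityIrreducibleOffSectorOfReciprocity
import Literature.NumberTheory.Automorphic.IsAutomorphicAE
import Literature.NumberTheory.Automorphic.GLnAdelicStructureProofs
import Literature.NumberTheory.GaloisRepresentations.GaloisRepFrobeniusProofs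
import HarnessLib

/-!
# SKELETON — line `directional-split` for the crux `ReciprocityUpToIrreducibility` (item stmt-Langlands-14328;
routes OrdinaryPrimeTransport / IrreducibilityBySelfDuality), crux-strategist planner-cstrat-stmt-Langlands-14328-r1-0

The BY-DIRECTION SPLIT of "the rest of the mountain" (EXEMPT-46 / BC2 redirect), as a registered line:
four stubs = the four PIECES filed as children of the crux,

* `stub_isobaricRigidityGLn`  (X₁, support: Jacquet–Shalika 1981 II Thm 4.4 for Borel–Jacquet data at
  unramified places; a theorem in print — in tree modulo Arthur–Clozel (2.2)/(2.3), K4 p105601 + p102640;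
  its own plan = line `split-x1-isobaric-rigidity`),
* `stub_weakExistence`        (X₂, crux: automorphic → Galois, weak form, BG Conj. 3.2.2 / Clozel 4.5;
  plan = line `split-x2-weak-existence`: regular sector at ONE prime + companions, irregular sector),
* `stub_weakAutomorphy`        (X₃, crux: Galois → automorphic a.e., Fontaine–Mazur–Langlands = lang.S03 at the
  pinned family; plan = line `split-x3-weak-automorphy`: potential automorphy over a solvable extension +
  solvable descent),
* `stub_pairCompatibilityR`    (X₄, crux: existence of canonically normalised reciprocity data + local–global
  compatibility at EVERY finite place for EVERY datum, Taylor Conj. 7 given the pair, ∀-Rec in lockstep with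
  the revised summit p141787; plan = line `split-x4-pair-compatibility`: LLC exists + v ∤ ℓ + v ∣ ℓ),

and the composition `ReciprocityUpToIrreducibility_of` concluding the crux BY NAME (route OrdinaryPrimeTransport's decl; IrreducibilityBySelfDuality's is the same text) with NO
extra hypothesis (the registered line `Sketch` needs the IrreducibilityBySelfDuality input `PairLBoundaryJS`;
here AC (2.2)–(2.3) sit inside X₁).  The seam is NOT trivial: X₂'s avatar is not asserted irreducible and X₄
speaks of irreducible pairs only — irreducibility is BOOTSTRAPPED from X₃ + X₁ through the landed
`stub_geometricConstituents` / `stub_deRhamBlocks` (argument of p116715).  The same stubs give the ∀-Rec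
re-type (item stmt-Langlands-17925) verbatim: `reciprocityUpToIrreducibilityR_text_of`.
Evidence file of the structural Theorems module (planner cannot propose into Theorems, D-0016):
`OrdinaryPrimeTransportReciprocityUpToIrreducibilitySplit.lean` attached to the item (rc 0, std axioms).
Stubs are the ONLY sorries.
-/

noncomputable section
set_option linter.dupNamespace false

namespace Summit.Langlands.Langlands.Cruxes.ReciprocityUpToIrreducibility.DirectionalSplit

open scoped NumberField Classical Polynomial BigOperators
open Filter IsDedekindDomain Polynomial
open Literature.NumberTheory.Automorphic Literature.NumberTheory.GaloisRepresentations
open Summit.Langlands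
open Summit.Langlands.Langlands.Theorems.ReciprocityUpToIrreducibility

/-! ## The four pieces (= the children of the split), as registered stubs -/

/-- **X₁ (support) — isobaric rigidity at unramified places** (JS 1981 II Thm 4.4 for representation data; in tree modulo AC (2.2)/(2.3): `Theorems.ReciprocityUpToIrreducibility.stub_isobaricRigidity`). [cite: JacquetShalikaAJM1981II, Thm. 4.4] -/
theorem stub_isobaricRigidityGLn :
    ∀ (K : Type) [Field K] [NumberField K] (n : ℕ) (hcpt : Literature.NumberTheory.Automorphic.isCompact_glFiniteIntegralLevel n K) (π : Literature.NumberTheory.Automorphic.CuspidalAutomorphicRepData n K hcpt) (k : ℕ) (m : Fin k → ℕ) (hm : ∀ i, Literature.NumberTheory.Automorphic.isCompact_glFiniteIntegralLevel (m i) K) (σ : ∀ i, Literature.NumberTheory.Automorphic.CuspidalAutomorphicRepData (m i) K (hm i)), 0 < n → 2 ≤ k → (∀ i, 0 < m i) → ¬ ∀ᶠ v : IsDedekindDomain.HeightOneSpectrum (NumberField.RingOfIntegers K) in Filter.cofinite, ∀ α : Multiset ℂ, π.1.HasSatakeParamAt v α → ∃ β : Fin k → Multiset ℂ, (∀ i,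 (σ i).1.HasSatakeParamAt v (β i)) ∧ α = ∑ i, β i := by
  sorry

/-- **X₂ (crux, OPEN) — weak existence** (automorphic → Galois; BG Conj. 3.2.2 without irreducibility/uniqueness/LGC; pinned-geometric avatar, a.e. compatible). [cite: BuzzardGeeLMS2014, Conj. 3.2.2] -/
theorem stub_weakExistence :
    ∀ (K : Type) [Field K] [NumberField K] (n : ℕ) (hcpt : Literature.NumberTheory.Automorphic.isCompact_glFiniteIntegralLevel n K), 0 < n → ∀ π : Literature.NumberTheory.Automorphic.CuspidalAutomorphicRepData n K hcpt, π.1.IsLAlgebraic → ∀ (ℓ : ℕ) [Fact ℓ.Prime] (ι : PadicAlgCl ℓ ≃+* ℂ), ∃ ρ : Literature.NumberTheory.GaloisRepresentations.FramedGaloisRep K (PadicAlgCl ℓ) n, ((∀ᶠ v : IsDedekindDomain.HeightOneSpectrum (NumberField.RingOfIntegers K) in Filter.cofinite, ρ.IsUnramifiedAt v) ∧ ∀ (v : IsDedekindDomain.HeightOneSpectrum (NumberField.RingOfIntegers K)) (hv : ((ℓ : ℕ) : NumberField.RingOfIntegers K) ∈ v.asIdeal), (Literature.NumberTheory.PAdicHodge.fontainePstAdicCompletion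 v ℓ hv).IsDeRhamFramed (ρ.toLocal v)) ∧ ∀ᶠ v : IsDedekindDomain.HeightOneSpectrum (NumberField.RingOfIntegers K) in Filter.cofinite, Summit.Langlands.SatakeFrobCompatibleAt ι π.1 ρ v := by
  sorry

/-- **X₃ (crux, OPEN) — weak automorphy** (Galois → automorphic a.e.; Fontaine–Mazur–Langlands; `=` lang.S03 at the pinned family, p117444). [cite: FontaineMazurGeometric1995, Conj. 1] -/
theorem stub_weakAutomorphy :
    ∀ (K : Type) [Field K] [NumberField K] (n : ℕ) (hcpt : Literature.NumberTheory.Automorphic.isCompact_glFiniteIntegralLevel n K), 0 < n → ∀ (ℓ : ℕ) [Fact ℓ.Prime] (ι : PadicAlgCl ℓ ≃+* ℂ) (ρ : Literature.NumberTheory.GaloisRepresentations.FramedGaloisRep K (PadicAlgCl ℓ) n), ρ.toGaloisRep.IsIrreducible → ((∀ᶠ v : IsDedekindDomain.HeightOneSpectrum (NumberField.RingOfIntegers K) in Filter.cofinite, ρ.IsUnramifiedAt v) ∧ ∀ (v : IsDedekindDomain.HeightOneSpectrum (NumberField.RingOfIntegers K)) (hv : ((ℓ : ℕ) : NumberField.RingOfIntegers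 K) ∈ v.asIdeal), (Literature.NumberTheory.PAdicHodge.fontainePstAdicCompletion v ℓ hv).IsDeRhamFramed (ρ.toLocal v)) → ∃ π : Literature.NumberTheory.Automorphic.CuspidalAutomorphicRepData n K hcpt, π.1.IsLAlgebraic ∧ ∀ᶠ v : IsDedekindDomain.HeightOneSpectrum (NumberField.RingOfIntegers K) in Filter.cofinite, Summit.Langlands.SatakeFrobCompatibleAt ι π.1 ρ v := by
  sorry

/-- **X₄ (crux, OPEN) — reciprocity data exist and local–global compatibility holds at every finite place for every datum** (Harris–Taylor/Henniart + Taylor 2004 Conj. 7 given the pair; ∀-Rec form). [cite: HarrisTaylorAMS2001, Thm. A] [cite: TaylorGaloisRepresentations2004, Conj. 7] -/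
theorem stub_pairCompatibilityR :
    ∀ (K : Type) [Field K] [NumberField K], Nonempty (ReciprocityData K) ∧ ∀ (Rec : ReciprocityData K) (n : ℕ) (hcpt : Literature.NumberTheory.Automorphic.isCompact_glFiniteIntegralLevel n K), 0 < n → ∀ (π : Literature.NumberTheory.Automorphic.CuspidalAutomorphicRepData n K hcpt), π.1.IsLAlgebraic → ∀ (ℓ : ℕ) [Fact ℓ.Prime] (ι : PadicAlgCl ℓ ≃+* ℂ) (ρ : Literature.NumberTheory.GaloisRepresentations.FramedGaloisRep K (PadicAlgCl ℓ) n), ρ.toGaloisRep.IsIrreducible → ((∀ᶠ v : IsDedekindDomain.HeightOneSpectrum (NumberField.RingOfIntegers K) in Filter.cofinite, ρ.IsUnramifiedAt v) ∧ ∀ (v : IsDedekindDomain.HeightOneSpectrum (NumberField.RingOfIntegers K)) (hv : ((ℓ : ℕ) : NumberField.RingOfIntegers K) ∈ v.asIdeal), (Literature.NumberTheory.PAdicHodge.fontainePstAdicCompletion v ℓ hv).IsDeRhamFramed (ρ.toLocal v)) → (∀ᶠ v : IsDedekindDomain.HeightOneSpectrum (NumberField.RingOfIntegers K) in Filter.cofinite,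 Summit.Langlands.SatakeFrobCompatibleAt ι π.1 ρ v) → ∀ v : IsDedekindDomain.HeightOneSpectrum (NumberField.RingOfIntegers K), Summit.Langlands.LocalGlobalCompatibleAt Rec ι π.1 ρ v := by
  sorry

/-! ## The seam: the isobaric bootstrap (copy of the structural module's proof; all ingredients landed) -/

/-- **The isobaric bootstrap from the pieces `X₁` (isobaric rigidity) and `X₃` (weak automorphy):**
every pinned-geometric `ℓ`-adic avatar Satake–Frobenius compatible a.e. with a cuspidal `π` of
`GL_n(𝔸_K)`, `n ≥ 1`, is irreducible — its irreducible pinned-geometric constituents (Jordan–Hölder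
dévissage + de Rham heredity, landed) are cuspidal-automorphic a.e. by `X₃`, their Satake families add up
to that of `π` a.e. (multiplicativity of the Satake–Frobenius dictionary), and `X₁` forbids `k ≥ 2`.
[folklore] -/
theorem isIrreducible_avatar_of_pieces
    (hIR : ∀ (K : Type) [Field K] [NumberField K] (n : ℕ) (hcpt : Literature.NumberTheory.Automorphic.isCompact_glFiniteIntegralLevel n K) (π : Literature.NumberTheory.Automorphic.CuspidalAutomorphicRepData n K hcpt) (k : ℕ) (m : Fin k → ℕ) (hm : ∀ i, Literature.NumberTheory.Automorphic.isCompact_glFiniteIntegralLevel (m i) K) (σ : ∀ i, Literature.NumberTheory.Automorphic.CuspidalAutomorphicRepData (m i) K (hm i)), 0 < n → 2 ≤ k → (∀ i, 0 < m i) → ¬ ∀ᶠ v : IsDedekindDomain.HeightOneSpectrum (NumberField.RingOfIntegers K) in Filter.cofinite, ∀ α : Multiset ℂ, π.1.HasSatakeParamAt v α → ∃ β : Fin k → Multiset ℂ, (∀ i, (σ i).1.HasSatakeParamAt v (β i)) ∧ α = ∑ i, β i)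
    (hB : ∀ (K : Type) [Field K] [NumberField K] (n : ℕ) (hcpt : Literature.NumberTheory.Automorphic.isCompact_glFiniteIntegralLevel n K), 0 < n → ∀ (ℓ : ℕ) [Fact ℓ.Prime] (ι : PadicAlgCl ℓ ≃+* ℂ) (ρ : Literature.NumberTheory.GaloisRepresentations.FramedGaloisRep K (PadicAlgCl ℓ) n), ρ.toGaloisRep.IsIrreducible → ((∀ᶠ v : IsDedekindDomain.HeightOneSpectrum (NumberField.RingOfIntegers K) in Filter.cofinite, ρ.IsUnramifiedAt v) ∧ ∀ (v : IsDedekindDomain.HeightOneSpectrum (NumberField.RingOfIntegers K)) (hv : ((ℓ : ℕ) : NumberField.RingOfIntegers K) ∈ v.asIdeal), (Literature.NumberTheory.PAdicHodge.fontainePstAdicCompletion v ℓ hv).IsDeRhamFramed (ρ.toLocal v)) → ∃ π : Literature.NumberTheory.Automorphic.CuspidalAutomorphicRepData n K hcpt, π.1.IsLAlgebraic ∧ ∀ᶠ v : IsDedekindDomain.HeightOneSpectrum (NumberField.RingOfIntegers K) in Filter.cofinite, Summit.Langlands.SatakeFrobCompatibleAt ι π.1 ρ v)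
    (K : Type) [Field K] [NumberField K] (n : ℕ) (hcpt : isCompact_glFiniteIntegralLevel n K)
    (hn : 0 < n) (π : CuspidalAutomorphicRepData n K hcpt) (ℓ : ℕ) [Fact ℓ.Prime]
    (ι : PadicAlgCl ℓ ≃+* ℂ) (ρ : FramedGaloisRep K (PadicAlgCl ℓ) n)
    (hgeo : (∀ᶠ v : HeightOneSpectrum (𝓞 K) in cofinite, ρ.IsUnramifiedAt v) ∧
      ∀ (v : HeightOneSpectrum (𝓞 K)) (hv : ((ℓ : ℕ) : 𝓞 K) ∈ v.asIdeal),
        (Literature.NumberTheory.PAdicHodge.fontainePstAdicCompletion v ℓ hv).IsDeRhamFramed (ρ.toLocal v))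
    (hρ : ∀ᶠ v : HeightOneSpectrum (𝓞 K) in cofinite, SatakeFrobCompatibleAt ι π.1 ρ v) :
    ρ.toGaloisRep.IsIrreducible := by
  obtain ⟨k, m, r, hr, hchar, -, hone⟩ :=
    stub_geometricConstituents stub_deRhamBlocks K ℓ n ρ hn hgeo
  by_cases hk1 : k = 1
  · exact hone hk1
  have hk0 : k ≠ 0 := by
    rintro rfl
    have h1 := hchar 1
    simp only [Finset.univ_eq_empty, Finset.prod_empty] at h1
    have hdeg : (FramedRep.charpoly ρ 1).natDegree = n := by
      simp [FramedRep.charpoly, Matrix.charpoly_natDegree_eq_dim]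
    rw [h1, natDegree_one] at hdeg
    omega
  have hk2 : 2 ≤ k := by omega
  have hσ : ∀ i, ∃ σ : CuspidalAutomorphicRepData (m i) K
      (isCompact_glFiniteIntegralLevel_holds (m i) K),
      ∀ᶠ v : HeightOneSpectrum (𝓞 K) in cofinite, SatakeFrobCompatibleAt ι σ.1 (r i) v := by
    intro i
    obtain ⟨σ, -, hcorr⟩ := hB K (m i) (isCompact_glFiniteIntegralLevel_holds (m i) K) (hr i).1 ℓ ι
      (r i) (hr i).2.1 (hr i).2.2
    exact ⟨σ, hcorr⟩
  choose σ hσc using hσ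
  refine (hIR K n hcpt π k m (fun i => isCompact_glFiniteIntegralLevel_holds (m i) K) σ hn hk2
    (fun i => (hr i).1) ?_).elim
  have hall : ∀ᶠ v : HeightOneSpectrum (𝓞 K) in cofinite,
      ∀ i, SatakeFrobCompatibleAt ι (σ i).1 (r i) v :=
    Filter.eventually_all.mpr hσc
  filter_upwards [hρ, hall] with v hv hvi
  intro α hα
  obtain ⟨α₀, hα₀, -, hcp⟩ := hv
  obtain rfl : α = α₀ := AutomorphicRepData.hasSatakeParamAt_unique_holds π.1 hα hα₀
  choose β hβ _hurβ hcpβ using hvi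
  refine ⟨β, hβ, ?_⟩
  have hprod : ρ.HasFrobCharpolyAt v (∏ i, arithFrobPolyOfSatake ι v.residueCard 1 (β i)) := by
    intro 𝔓 h𝔓 τ hτ
    rw [hchar τ]
    exact Finset.prod_congr rfl fun i _ => hcpβ i 𝔓 h𝔓 τ hτ
  rw [← Summit.Langlands.Langlands.Theorems.IrreducibleOffSector.arithFrobPolyOfSatake_sum] at hprod
  have heq : arithFrobPolyOfSatake ι v.residueCard 1 α =
      arithFrobPolyOfSatake ι v.residueCard 1 (∑ i, β i) :=
    GaloisRep.HasFrobCharpolyAt.unique_holds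
      ((FramedGaloisRep.hasFrobCharpolyAt_toGaloisRep_iff v _ ρ).mpr hcp)
      ((FramedGaloisRep.hasFrobCharpolyAt_toGaloisRep_iff v _ ρ).mpr hprod)
  exact arithFrobPolyOfSatake_one_injective ι _ heq

/-- **The ∀-Rec re-type of the crux (item stmt-Langlands-17925, text verbatim) from the four stubs.** -/
theorem reciprocityUpToIrreducibilityR_text_of :
    ∀ (F : Type) [Field F] [NumberField F], Nonempty (ReciprocityData F) ∧ ∀ (Rec : ReciprocityData F) (n : ℕ), 0 < n → ∀ hcpt : Literature.NumberTheory.Automorphic.isCompact_glFiniteIntegralLevel n F, (∀ π : Literature.NumberTheory.Automorphic.CuspidalAutomorphicRepData n F hcpt, π.1.IsLAlgebraic → ∀ (ℓ : ℕ) [Fact ℓ.Prime] (ι : PadicAlgCl ℓ ≃+* ℂ), ∃ ρ : Literature.NumberTheory.GaloisRepresentations.FramedGaloisRep F (PadicAlgCl ℓ) n, IsGeometricFramed Rec ρ ∧ Corresponds Rec ι π.1 ρ) ∧ GaloisToAutomorphic n Rec hcpt := by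
  intro F _ _
  obtain ⟨hne, hRec⟩ := stub_pairCompatibilityR F
  refine ⟨hne, fun Rec n hn hcpt => ⟨fun π hLalg ℓ _ ι => ?_, fun ℓ _ ι ρ hirr hgeo => ?_⟩⟩
  · obtain ⟨ρ, hgeo, hρ⟩ := stub_weakExistence F n hcpt hn π hLalg ℓ ι
    have hirr : ρ.toGaloisRep.IsIrreducible :=
      isIrreducible_avatar_of_pieces stub_isobaricRigidityGLn stub_weakAutomorphy F n hcpt hn π ℓ ι ρ hgeo hρ
    exact ⟨ρ, hgeo, hρ, hRec Rec n hcpt hn π hLalg ℓ ι ρ hirr hgeo hρ⟩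
  · obtain ⟨π, hLalg, hρ⟩ := stub_weakAutomorphy F n hcpt hn ℓ ι ρ hirr hgeo
    exact ⟨π, hLalg, hρ, hRec Rec n hcpt hn π hLalg ℓ ι ρ hirr hgeo hρ⟩

/-- **COMPOSITION — the crux BY NAME (route OrdinaryPrimeTransport's decl of item stmt-Langlands-14328; the
IrreducibilityBySelfDuality decl has the same text verbatim) from the four registered stubs, no further hypothesis.** -/
theorem ReciprocityUpToIrreducibility_of :
    Summit.Langlands.Langlands.Theses.OrdinaryPrimeTransport.ReciprocityUpToIrreducibility := by
  intro F _ _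
  obtain ⟨⟨Rec⟩, hall⟩ := reciprocityUpToIrreducibilityR_text_of F
  exact ⟨Rec, fun n hn hcpt => hall Rec n hn hcpt⟩

end Summit.Langlands.Langlands.Cruxes.ReciprocityUpToIrreducibility.DirectionalSplit

end
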